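import Literature.AnabelianGeometry.EtaleTheta.Discharge.Sec5DegenerateDatum

/-!
# [EtTh] §5, Lemma 5.8 / 5.9 (iv): the universal closure of the schema `ConstOutTransported` is refuted at the degenerate §5 datum (pp. 331–332 / PDF pp. 105–106)

Mochizuki, *The étale theta function and its Frobenioid-theoretic manifestations*, Publ. RIMS **45**
(2009) [cite: MochizukiEtTh2009, Lem 5.8 p.331 (PDF p.105)].  abc-iut cell, block F (fact-proving wave), seat
abc-iut-f-115; PROOF-ONLY companion (theorems only) of `Discharge/Sec5DegenerateDatum.lean` (this seat: the
degenerate §5 datum `Sec5Toy.datum` over the one-object base, built by abc-iut-L2-t4's `ThetaFrobenioid.ofThetaEnvData`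
over the §2 datum `Sec5Toy.thetaEnvData`) and of abc-iut-L2-t11's `Discharge/Sec5EnvelopeTopology.lean`, whose named
hypothesis `ThetaFrobenioid.ConstOutTransported H h8 DK T ι m hY hχ` — "the transported outer actions of the constants
and of the residual Kummer part `DK` of `D ⊆ Out(E^Π_N)` lie in `D_Y`" (Lemma 5.8: "a natural outer action of
`(O_K^×)^{1/N}/μ_N(B_N) ⥲ O_K^×` on `E_N` … extends to … `K^×`"; Def. 2.13 (i) p.273 (PDF p.47)) — is FACT-LIST row
F-0518, a SCHEMA over the §5 datum, the §2 datum, the identifications and the free parameter `DK`.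

PROVED here:
* `Sec5Toy.shift_eq_one`, `Sec5Toy.conjX_eq_one`, **`Sec5Toy.DY_eq_bot`** — for the degenerate §2 datum (`μ_1 = 1`,
  `Π^tp_X` abelian) every Kummer shift and every `Gal(Y/X)`-conjugation of `Π^tp_Y[μ_1]` is the identity, so
  abc-iut-L2-t2's `D_Y = ⟨Im K^×, Gal(Y/X)⟩` is TRIVIAL there;
* `Sec5Toy.invOut_ne_one` — `E^Π_N` of the degenerate datum is abelian and inversion is a bi-continuous automorphism
  of it that is NOT inner (it moves `(1, (0,1,0))`), i.e. a non-trivial element of `Out(E^Π_N)`;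
* **`Sec5Toy.not_constOutTransported_datum`** — hence at `DK := Set.univ` (for EVERY `m`, `hY`, `hχ`) the transported
  `constOut ∪ DK` is NOT contained in `D_Y = 1` (transport along `E^Π_N ⥲ Π^tp_Y[μ_N]` is injective);
* **`Sec5Toy.not_forall_constOutTransported`** (F-0518) — the universal closure of `ConstOutTransported` over (§5 data at
  the one-object base, `Facts`, `DK`, §2 data, `ι`, `m`, `hY`, `hχ`) is FALSE.  Its instance forms of record are
  abc-iut-L2-t11's `constOutTransported_of` / `BiratAutAction.constOutTransported_birat` (at `DK := kummerOut`) /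
  `constOutTransported_preimage` (at the canonical `DK₀`), each modulo the Kummer-theory inflation input `hinfl`
  (proof of Lemma 5.8: "`Π^tp_Y` [i.e., `G_K`, via `Π^tp_Y ↠ G_K`] acts …", "since `Y` is geometrically connected"),
  unchanged.  FACT-LIST R5: named instances only.
HONEST FRAMING: a counterexample to the ∀-closure of a typed PREDICATE with a free set-parameter, at a degenerate datum
that is NOT the tempered Frobenioid of a curve; nothing of [EtTh] is refuted or asserted; no FACT-LIST row is thereby
proved; typed ≠ proved; nothing here bears on [IUTchIII] Cor. 3.12 and no side is taken on any disputed claim.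
-/

noncomputable section

namespace Literature.AnabelianGeometry.EtaleTheta

open CategoryTheory Literature.AlgebraicGeometry.Frobenioids

namespace Sec5Toy

/-! ### `D_Y` of the degenerate §2 datum is trivial -/

/-- At the degenerate §2 datum every cocycle shift of `Π^tp_Y[μ_1]` is the identity (`μ_1 = 1`).
[cite: MochizukiEtTh2009, Prop 2.14 (ii) p.275 (PDF p.49)] -/
theorem shift_eq_one {δ : thetaEnvData.PiY → thetaEnvData.mu}
    (hδ : CycEnvelope.IsEnvCocycle thetaEnvData.augY thetaEnvData.chi δ) : CycEnvelope.shift hδ = 1 := by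
  refine MulEquiv.ext fun x => SemidirectProduct.ext ?_ rfl
  exact Subsingleton.elim (α := PUnit) _ _

/-- At the degenerate §2 datum every `Gal(Y/X)`-conjugation of `Π^tp_Y[μ_1]` is the identity (`Π^tp_X` is abelian,
`μ_1 = 1`).  [cite: MochizukiEtTh2009, Def 2.13 (i) p.273 (PDF p.47)] -/
theorem conjX_eq_one (g : thetaEnvData.PiX) : thetaEnvData.conjX g = 1 := by
  refine MulEquiv.ext fun x => SemidirectProduct.ext ?_ (Subtype.ext ?_)
  · exact Subsingleton.elim (α := PUnit) _ _
  · change g * (x.right : thetaEnvData.PiX) * g⁻¹ = (x.right : thetaEnvData.PiX)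
    have hc : g * (x.right : thetaEnvData.PiX) = (x.right : thetaEnvData.PiX) * g := @mul_comm Pi _ _ _
    rw [hc, mul_inv_cancel_right]

/-- **`D_Y = 1` for the degenerate §2 datum**: abc-iut-L2-t2's `D_Y := ⟨kummerOut ∪ galOut⟩ ⊆ Out(Π^tp_Y[μ_N])`
(Def. 2.13 (i): "the subgroup generated by the image of `K^×`, `Gal(Y/X)`") is generated by identities there.
[cite: MochizukiEtTh2009, Def 2.13 (i) p.273 (PDF p.47)] -/
theorem DY_eq_bot : thetaEnvData.DY = ⊥ := by
  rw [ThetaEnvData.DY, Subgroup.closure_eq_bot_iff]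
  rintro d (⟨δ, hδ, hc, rfl⟩ | ⟨g, hc, rfl⟩)
  · have h1 : (⟨CycEnvelope.shift hδ, hc⟩ : contMulAut thetaEnvData.env) = 1 := Subtype.ext (shift_eq_one hδ)
    rw [Set.mem_singleton_iff, h1, map_one]
  · have h1 : (⟨thetaEnvData.conjX g, hc⟩ : contMulAut thetaEnvData.env) = 1 := Subtype.ext (conjX_eq_one g)
    rw [Set.mem_singleton_iff, h1, map_one]

/-! ### `E^Π_N` of the degenerate datum is abelian; inversion is a non-inner bi-continuous automorphism -/

/-- The ambient group `Aut_C(B_N) × Π^tp_X̲` of `E^Π_N` is abelian at the degenerate datum.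
[cite: MochizukiEtTh2009, Lem 5.9 (iv) p.332 (PDF p.106)] -/
theorem ambient_comm (a b : Aut datum.BN × datum.PiX) : a * b = b * a :=
  haveI := subsingleton_aut_BN
  Prod.ext (Subsingleton.elim _ _) (@mul_comm Pi _ a.2 b.2)

/-- `E^Π_N` is abelian at the degenerate datum. [cite: MochizukiEtTh2009, Lem 5.9 (iv) p.332 (PDF p.106)] -/
theorem epin_comm (x y : datum.EPiN) : x * y = y * x :=
  Subtype.ext (ambient_comm _ _)

/-- Inversion on `E^Π_N` is continuous for the "evident topology" (componentwise inversion; `Aut_C(B_N)` discrete).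
[cite: MochizukiEtTh2009, Lem 5.9 (iv) p.332 (PDF p.106)] -/
theorem continuous_inv_EPiN : Continuous fun x : datum.EPiN => x⁻¹ :=
  ThetaFrobenioid.continuous_of_componentwise _ (fun a => a⁻¹) (fun y => y⁻¹) continuous_inv fun _ => rfl

/-- An inner automorphism of the (abelian) group `E^Π_N` of the degenerate datum is the identity.
[cite: MochizukiEtTh2009, Lem 5.9 (iv) p.332 (PDF p.106)] -/
theorem conj_EPiN_apply (g x : datum.EPiN) : MulAut.conj g x = x := by
  rw [MulAut.conj_apply, epin_comm g x, mul_inv_cancel_right]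

/-- `(1, (0,1,0)) ∈ E^Π_N` is not its own inverse. [cite: MochizukiEtTh2009, Lem 5.9 (iv) p.332 (PDF p.106)] -/
theorem inv_one_y₀_ne :
    (⟨((1 : Aut datum.BN), (y₀ : datum.PiX)), one_y₀_mem_EPiN⟩ : datum.EPiN)⁻¹ ≠
      ⟨((1 : Aut datum.BN), (y₀ : datum.PiX)), one_y₀_mem_EPiN⟩ := by
  intro h
  have h2 : (y₀⁻¹ : Pi).2.1 = (y₀ : Pi).2.1 := congrArg (fun z : datum.EPiN => (z : Aut datum.BN × datum.PiX).2.2.1) h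
  exact absurd h2 (by decide)

/-- **A non-trivial element of `Out(E^Π_N)` at the degenerate datum**: the class of a bi-continuous automorphism
`φ` acting as inversion is not `1` — inversion is not inner, since inner automorphisms of the abelian `E^Π_N` are
trivial while inversion moves `(1, (0,1,0))`.  [cite: MochizukiEtTh2009, Lem 5.9 (iv) p.332 (PDF p.106)] -/
theorem invOut_ne_one (φ : contMulAut datum.EPiN) (hφ : ∀ x : datum.EPiN, (φ : MulAut datum.EPiN) x = x⁻¹) :
    TopOut.mk _ φ ≠ 1 := by
  intro h
  rw [QuotientGroup.mk'_apply, QuotientGroup.eq_one_iff, Subgroup.mem_subgroupOf] at h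
  obtain ⟨g, hg⟩ := h
  have key := MulEquiv.congr_fun hg ⟨((1 : Aut datum.BN), (y₀ : datum.PiX)), one_y₀_mem_EPiN⟩
  rw [conj_EPiN_apply, hφ] at key
  exact inv_one_y₀_ne key.symm

/-! ### F-0518: the universal closure of `ConstOutTransported` is false -/

/-- **F-0518 at the degenerate datum**: for `DK := Set.univ` — and ANY identification data `m`, `hY`, `hχ` with
`ι := id` — the transported `constOut ∪ DK` is NOT contained in `D_Y`: `D_Y = 1` for the degenerate §2 datum, while
`DK = Out(E^Π_N)` contains the non-trivial class of inversion and transport along `E^Π_N ⥲ Π^tp_Y[μ_N]`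
(Lemma 5.9 (iv)) is injective.  [cite: MochizukiEtTh2009, Lem 5.9 (iv) p.332 (PDF p.106)] -/
theorem not_constOutTransported_datum (m : datum.muTorsion datum.BN datum.N ≃* thetaEnvData.mu)
    (hY : datum.IdentifiesPiY thetaEnvData (ContinuousMulEquiv.refl datum.PiX).toMulEquiv)
    (hχ : datum.CyclotomicCharacterCompat thetaEnvData (ContinuousMulEquiv.refl datum.PiX).toMulEquiv m) :
    ¬ datum.ConstOutTransported facts_datum facts_datum.constantsEqNormalizer Set.univ thetaEnvData
        (ContinuousMulEquiv.refl datum.PiX) m hY hχ := by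
  intro h
  -- the inversion automorphism of the abelian topological group `E^Π_N`
  let φ₀ : MulAut datum.EPiN :=
    { toFun := fun x => x⁻¹
      invFun := fun x => x⁻¹
      left_inv := fun x => inv_inv x
      right_inv := fun x => inv_inv x
      map_mul' := fun x y => (mul_inv_rev x y).trans (epin_comm _ _) }
  have hφ₀ : φ₀ ∈ contMulAut datum.EPiN := ⟨continuous_inv_EPiN, continuous_inv_EPiN⟩
  set e := datum.envContIso facts_datum thetaEnvData (ContinuousMulEquiv.refl datum.PiX) m hY hχ with he
  have hmem : TopOut.transport e (TopOut.mk _ ⟨φ₀, hφ₀⟩) ∈ (thetaEnvData.DY : Set (TopOut thetaEnvData.env)) :=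
    h ⟨TopOut.mk _ ⟨φ₀, hφ₀⟩, Or.inr (Set.mem_univ _), rfl⟩
  rw [DY_eq_bot, SetLike.mem_coe, Subgroup.mem_bot] at hmem
  have hback := ThetaFrobenioid.transport_transport_symm_apply e.symm (TopOut.mk _ ⟨φ₀, hφ₀⟩)
  rw [ContinuousMulEquiv.symm_symm, hmem, map_one] at hback
  exact invOut_ne_one ⟨φ₀, hφ₀⟩ (fun _ => rfl) hback.symm

/-- **F-0518: the universal closure of the schema `ConstOutTransported` is FALSE** (already over §5 data at the
one-object base category): the residual Kummer part `DK` is a free parameter and `D_Y` can be trivial.  The instance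
forms of record — abc-iut-L2-t11's `constOutTransported_of`, `BiratAutAction.constOutTransported_birat`
(`DK := kummerOut`), `constOutTransported_preimage` (canonical `DK₀`) — are each modulo the Kummer-theory inflation
input `hinfl` of Lemma 5.8's proof and are unchanged.  FACT-LIST R5: named instances only.
[cite: MochizukiEtTh2009, Lem 5.8 p.331 (PDF p.105)] -/
theorem not_forall_constOutTransported :
    ¬ ∀ (𝔉 : ThetaFrobenioid.{0} (Discrete PUnit.{1}) (Discrete PUnit.{1})) (H : 𝔉.Facts)
        (h8 : 𝔉.ConstantsEqNormalizer) (DK : Set (TopOut 𝔉.EPiN)) (T : ThetaEnvData.{0} 𝔉.N)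
        (ι : 𝔉.PiX ≃ₜ* T.PiX) (m : 𝔉.muTorsion 𝔉.BN 𝔉.N ≃* T.mu) (hY : 𝔉.IdentifiesPiY T ι.toMulEquiv)
        (hχ : 𝔉.CyclotomicCharacterCompat T ι.toMulEquiv m), 𝔉.ConstOutTransported H h8 DK T ι m hY hχ := by
  intro h
  haveI := subsingleton_aut_BN
  let m : datum.muTorsion datum.BN datum.N ≃* thetaEnvData.mu :=
    { toFun := fun _ => PUnit.unit
      invFun := fun _ => 1
      left_inv := fun _ => Subsingleton.elim _ _
      right_inv := fun _ => rfl
      map_mul' := fun _ _ => rfl }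
  have hY : datum.IdentifiesPiY thetaEnvData (ContinuousMulEquiv.refl datum.PiX).toMulEquiv := fun y => by
    rw [datum_PiY]
    exact Iff.rfl
  have hχ : datum.CyclotomicCharacterCompat thetaEnvData (ContinuousMulEquiv.refl datum.PiX).toMulEquiv m :=
    fun _ _ _ _ _ => rfl
  exact not_constOutTransported_datum m hY hχ
    (h datum facts_datum facts_datum.constantsEqNormalizer Set.univ thetaEnvData _ m hY hχ)

end Sec5Toy

end Literature.AnabelianGeometry.EtaleTheta
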